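import Summits.ValiantsHypothesis.ValiantsHypothesis.Theorems.NumTameGrowthLemma
import Literature.Computability.AlgebraicComplexity.ExactVP0PerProjection

/-!
# Route NumTame — crux `TameNF` (stmt-ValiantsHypothesis-5385), line `birth`, stub `stub_growth`

Registered line `Cruxes/TameNF/Lines/birth.lean` (planner-skel 2026-08-17) cuts the crux
`Summit.ValiantsHypothesis.ValiantsHypothesis.Theses.NumTame.TameNF` (cube-tame normal form) into
three named stubs composed by the sorry-free `TameNF_of`:
`stub_degreeNF` (Strassen's degree normal form), `stub_smallConstants` (the open core) and
`stub_growth` (the growth lemma on the Boolean cube). This file proves `stub_growth` VERBATIM: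

> every gate of fan-in `1` or `2`, constants and sum weights of modulus `≤ 2^R`, all gate formal
> degrees `≤ D` ⇒ every gate value at a `0/1` point has modulus `≤ 2^((R+1)·D·(|P|+1))`.

Proof: the tree's REPAIRED growth lemma `NumTameGrowth.norm_gateValues_le`
(`Theorems/NumTameGrowthLemma.lean`: gate number `j` is bounded by `2^((R+1)·(j+2)·fdeg_j)` as soon
as every formal degree is `≥ 1`) plus the observation that in the tree's model — inputs AND
constants have formal degree `1`, junk references read `1` (`ArithCircuit.Operand.formalDegree`) —
fan-in `≥ 1` at every gate forces every gate formal degree to be `≥ 1` (tree: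
`ArithCircuit.forall_one_le_gateFormalDegrees`, `Literature/…/ExactVP0PerProjection.lean`); finally `(j+2)·fdeg_j ≤ (|P|+1)·D` for `j < |P|`.
The fan-in hypothesis is necessary (empty product gate: value `1`, formal degree `0`, towers
`2^(2^k)` — refuter evidence `NumTameTowerLoophole` on stmt-5388).

Honest framing: bookkeeping on a registered line of an OPEN route; the crux `TameNF`, its open
core `stub_smallConstants` and the route remain open; nothing here bears on `VP ≠ VNP`.

## References

* P. Bürgisser, *On defining integers and proving arithmetic circuit lower bounds*,
  Comput. Complexity 18 (2009), §2.2 (formal degree). [cite: Burgisser2006, §2.2]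
-/

-- Sub = Summit layout duplicates the namespace component
set_option linter.dupNamespace false

noncomputable section

namespace Summit.ValiantsHypothesis.ValiantsHypothesis.Theorems.NumTame.TameNF

open Literature.Computability.AlgebraicComplexity ArithCircuit

/-- **Growth lemma on the Boolean cube** (stub `stub_growth` of line `birth`, registered signature
verbatim = `Cruxes.TameNF.Birth.CubeGrowth`): every gate of fan-in `1` or `2`, constants and sum
weights of modulus `≤ 2^R`, all gate formal degrees `≤ D` ⇒ every gate value at a `0/1` point has
modulus `≤ 2^((R+1)·D·(|P|+1))`. From `NumTameGrowth.norm_gateValues_le` (gate `j`: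
`≤ 2^((R+1)(j+2)·fdeg_j)`), `ArithCircuit.forall_one_le_gateFormalDegrees` (fan-in `≥ 1` ⇒ formal
degree `≥ 1`), and `(j+2)·fdeg_j ≤ (|P|+1)·D`.
[cite: Burgisser2006, §2.2] -/
theorem stub_growth :
    ∀ (n : ℕ) (P : ArithCircuit ℂ (Fin n)) (R D : ℕ), P.IsFanInTwo →
      (∀ g ∈ P.gates, 1 ≤ ArithCircuit.Gate.fanIn g) →
      (∀ g ∈ P.gates, ∀ u ∈ ArithCircuit.Gate.args g, ∀ a : ℂ,
        u = ArithCircuit.Operand.const a → ‖a‖ ≤ (2 : ℝ) ^ R) →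
      (∀ args, ArithCircuit.Gate.sum args ∈ P.gates → ∀ a ∈ args, ‖a.1‖ ≤ (2 : ℝ) ^ R) →
      (∀ d ∈ ArithCircuit.gateFormalDegrees P.gates, d ≤ D) →
      ∀ g ∈ ArithCircuit.gateValues P.gates, ∀ x : Fin n → Bool,
        ‖MvPolynomial.eval (boolPoint ℂ x) g‖ ≤ (2 : ℝ) ^ ((R + 1) * D * (P.size + 1)) := by
  intro n P R D hfan hfanIn hconst hw hdeg g hg x
  obtain ⟨j, hj, rfl⟩ := List.getElem_of_mem hg
  have hpos : ∀ d ∈ gateFormalDegrees P.gates, 1 ≤ d :=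
    forall_one_le_gateFormalDegrees P.gates hfanIn
  refine (NumTameGrowth.norm_gateValues_le x R P.gates hfan hconst hw hpos j hj).trans
    (pow_le_pow_right₀ (by norm_num) ?_)
  have hjs : j + 2 ≤ P.size + 1 := by
    have hl := gateValues_length P.gates
    rw [ArithCircuit.size]
    omega
  have hdD : (gateFormalDegrees P.gates)[j]'(by simpa using hj) ≤ D :=
    hdeg _ (List.getElem_mem _)
  calc (R + 1) * (j + 2) * (gateFormalDegrees P.gates)[j]'(by simpa using hj)
      ≤ (R + 1) * (P.size + 1) * D := Nat.mul_le_mul (Nat.mul_le_mul_left _ hjs) hdD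
    _ = (R + 1) * D * (P.size + 1) := by ring

end Summit.ValiantsHypothesis.ValiantsHypothesis.Theorems.NumTame.TameNF

end
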